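import Literature.Analysis.ODE.HeunFlip
import Literature.Analysis.ODE.HeunMobius
import Summits.Ventures.KdS.SpinFlipPolynomial
import HarnessLib

/-!
# Venture KdS — analysis toolkit for the Teukolsky–Starobinsky transfer (III): monomial solutions
# of Heun's equation and the extreme lattice stratum

HONEST FRAMING (venture `Summits/Ventures/KdS`, cell `pub-kds`): general-Heun algebra and one more
piece of polynomial rigidity, used by `RouteWSpinFlip.lean` / `RouteWSpinFlipLattice.lean` to close
the EXTREME stratum of the cosmological lattice (the only stratum in the open upper half-plane for
spins `s ≤ 2`). Contents (Umetsu's normalisation `GeneralHeun.IsSolutionOn`):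

* `IsSolutionOn.congr_eqOn`: solutions may be replaced by functions agreeing on the open set;
* `accessory_of_monomial_solution`: if `c·(1−x)^p` (`c ≠ 0`, `p ∈ ℕ`) solves Heun's equation on
  `(0,1)` then the accessory parameter is `q = p·γ·a_H` (the constant coefficient of the residual
  quadratic, obtained by continuity at `x → 0⁺`);
* `isSolutionOn_monomial`: conversely `(z−1)^p` solves Heun's equation on `(1, a_H)` when
  `p = 1 − δ`, `(p+α)(p+β) = 0` and `q = pγa_H` (the residual quadratic then vanishes identically);
* `eq_monomial_of_iterate_deriv_eq_zero_of_branch_extreme`: a function on `(0,1)` with `u^{(N)} ≡ 0`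
  and the branch `(1−x)^{N−1}·(smooth across 1)` at `1⁻` is `c·(1−x)^{N−1}`;
* `mobiusQ_of_flipQ_extreme`: the accessory condition of the extreme stratum transported through the
  Möbius automorphism `x = a(z−1)/z` of `HeunMobius` (pure algebra; data with `α = N+1`, `δ = N`).
-/

noncomputable section

open Set Complex Filter Topology Polynomial

namespace Summit.Ventures.KdS

namespace SpinFlipTS

open Literature.Geometry.Lorentzian.Kerr.Costa2019 (iterate_deriv_smooth iterate_deriv_eqOn)
open Literature.Analysis.ODE Literature.Analysis.ODE.GeneralHeun

/-! ### Solutions are insensitive to changes off the open set -/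

/-- If `f` solves Heun's equation on an open set `U` and `g = f` on `U`, then `g` solves it on `U`. -/
theorem IsSolutionOn.congr_eqOn {aH α β γ δ ε q : ℂ} {U : Set ℝ} (hU : IsOpen U) {f g : ℝ → ℂ}
    (hf : IsSolutionOn aH α β γ δ ε q U f) (hfg : EqOn f g U) : IsSolutionOn aH α β γ δ ε q U g := by
  obtain ⟨f₁, f₂, h⟩ := hf
  refine ⟨f₁, f₂, fun x hx => ?_⟩
  obtain ⟨h1, h2, h3⟩ := h x hx
  have hev : f =ᶠ[𝓝 x] g := by
    filter_upwards [hU.mem_nhds hx] with t ht using hfg ht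
  refine ⟨h1.congr_of_eventuallyEq hev.symm, h2, ?_⟩
  rw [← hfg hx]
  exact h3

/-! ### Monomial solutions: the accessory condition -/

/-- **If `c(1−x)^p` solves Heun's equation on `(0,1)` then `q = pγa_H`.** (Plugging in: the residual
divided by `c(1−x)^{p−1}`… is a quadratic in `x` whose constant coefficient is `q − pγa_H`; here it is
extracted by letting `x → 0⁺` in the continuous residual.) -/
theorem accessory_of_monomial_solution {aH α β γ δ ε q : ℂ} {c : ℂ} (hc : c ≠ 0) {p : ℕ}
    (hsol : IsSolutionOn aH α β γ δ ε q (Ioo (0 : ℝ) 1) (fun x => c * ((1 - x : ℝ) : ℂ) ^ p)) :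
    q = p * γ * aH := by
  obtain ⟨f₁, f₂, h⟩ := hsol
  -- the actual derivatives of the monomial
  set g : ℝ → ℂ := fun x => c * ((1 - x : ℝ) : ℂ) ^ p with hg
  set g₁ : ℝ → ℂ := fun x => c * (-(p : ℂ) * ((1 - x : ℝ) : ℂ) ^ (p - 1)) with hg₁
  set g₂ : ℝ → ℂ := fun x => c * ((p : ℂ) * ((p - 1 : ℕ) : ℂ) * ((1 - x : ℝ) : ℂ) ^ (p - 1 - 1)) with hg₂
  have hcast : ∀ x : ℝ, HasDerivAt (fun t : ℝ => ((1 - t : ℝ) : ℂ)) (-1) x := by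
    intro x
    have h1 : HasDerivAt (fun t : ℝ => (1 - t : ℝ)) (-1) x := by
      simpa using (hasDerivAt_id x).const_sub 1
    simpa using h1.ofReal_comp
  have hd1 : ∀ x : ℝ, HasDerivAt g (g₁ x) x := by
    intro x
    have h := ((hcast x).pow p).const_mul c
    refine h.congr_deriv ?_
    simp only [hg₁]
    push_cast
    ring
  have hd2 : ∀ x : ℝ, HasDerivAt g₁ (g₂ x) x := by
    intro x
    have h := (((hcast x).pow (p - 1)).const_mul (-(p : ℂ))).const_mul c
    refine h.congr_deriv ?_
    simp only [hg₂]
    push_cast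
    ring
  -- the residual with the true derivatives vanishes on (0,1)
  set Φ : ℝ → ℂ := fun x => lead aH x * g₂ x + mid aH γ δ ε x * g₁ x + low α β q x * g x with hΦ
  have hΦ0 : ∀ x ∈ Ioo (0 : ℝ) 1, Φ x = 0 := by
    intro x hx
    obtain ⟨h1, h2, h3⟩ := h x hx
    have e1 : f₁ x = g₁ x := h1.unique (hd1 x)
    have hev : f₁ =ᶠ[𝓝 x] g₁ := by
      filter_upwards [isOpen_Ioo.mem_nhds hx] with t ht using (h t ht).1.unique (hd1 t)
    have e2 : f₂ x = g₂ x := (h2.congr_of_eventuallyEq hev.symm |>.unique (hd2 x))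
    simp only [hΦ]
    rw [← e1, ← e2]
    exact h3
  -- `Φ` is continuous, hence `Φ 0 = 0`
  have hΦc : Continuous Φ := by
    have hc1 : Continuous fun t : ℝ => ((1 - t : ℝ) : ℂ) :=
      Complex.continuous_ofReal.comp (continuous_const.sub continuous_id)
    have hx : Continuous fun t : ℝ => ((t : ℝ) : ℂ) := Complex.continuous_ofReal
    simp only [hΦ, hg, hg₁, hg₂, lead, mid, low]
    fun_prop
  have hΦ00 : Φ 0 = 0 := by
    have h1 : Tendsto Φ (𝓝[>] (0 : ℝ)) (𝓝 (Φ 0)) :=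
      (hΦc.tendsto 0).mono_left nhdsWithin_le_nhds
    have h2 : Tendsto Φ (𝓝[>] (0 : ℝ)) (𝓝 0) := by
      refine tendsto_const_nhds.congr' ?_
      filter_upwards [Ioo_mem_nhdsGT (zero_lt_one' ℝ)] with x hx using (hΦ0 x hx).symm
    exact tendsto_nhds_unique h1 h2
  -- read off the constant coefficient
  have hval : Φ 0 = c * (q - p * γ * aH) := by
    simp only [hΦ, hg, hg₁, hg₂, lead, mid, low]
    push_cast
    ring
  rw [hval] at hΦ00
  have := (mul_eq_zero.mp hΦ00).resolve_left hc
  linear_combination this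

/-! ### Monomial solutions: sufficiency on `(1, a_H)` -/

/-- `d/dz (z − 1)^p = (z − 1)^p · p/(z − 1)` for `z > 1` (principal power of a positive real). -/
private theorem hasDerivAt_sub_one_cpow (p : ℂ) {r : ℝ} (hr : 1 < r) :
    HasDerivAt (fun x : ℝ => ((x - 1 : ℝ) : ℂ) ^ p)
      (((r - 1 : ℝ) : ℂ) ^ p * (p / ((r : ℂ) - 1))) r := by
  have hpos : (0 : ℝ) < r - 1 := sub_pos.2 hr
  have hslit : ((r : ℂ) - 1) ∈ slitPlane := by
    have : ((r - 1 : ℝ) : ℂ) ∈ slitPlane := Complex.ofReal_mem_slitPlane.2 hpos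
    simpa using this
  have hne : ((r : ℂ) - 1) ≠ 0 := by
    have : ((r - 1 : ℝ) : ℂ) ≠ 0 := by exact_mod_cast hpos.ne'
    simpa using this
  have h1 : HasDerivAt (fun z : ℂ => (z - 1) ^ p) (p * ((r : ℂ) - 1) ^ (p - 1) * 1) (r : ℂ) :=
    ((hasDerivAt_id (r : ℂ)).sub_const (1 : ℂ)).cpow_const hslit
  have hfun : (fun x : ℝ => ((x - 1 : ℝ) : ℂ) ^ p) = fun y : ℝ => ((y : ℂ) - 1) ^ p := by
    funext y; push_cast; ring_nf
  rw [hfun]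
  refine h1.comp_ofReal.congr_deriv ?_
  rw [mul_one, Complex.cpow_sub _ _ hne, Complex.cpow_one]
  push_cast
  field_simp

/-- **`(z−1)^p` solves Heun's equation on `(1, a_H)`** (`a_H` real) provided `p = 1 − δ`,
`(p + α)(p + β) = 0` and `q = pγa_H` (with the Fuchs relation): the residual
`p(p−1)z(z−a_H) + p·mid + (αβz+q)(z−1)` is the quadratic
`(p+α)(p+β)z² + p(p+δ−1)(1−a_H)z + (pγa_H − q)`. -/
theorem isSolutionOn_monomial {aH : ℝ} {α β γ δ ε q p : ℂ}
    (hF : γ + δ + ε = α + β + 1) (hp : p = 1 - δ) (hind : (p + α) * (p + β) = 0)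
    (hq : q = p * γ * aH) :
    IsSolutionOn (aH : ℂ) α β γ δ ε q (Ioo 1 aH) (fun z => ((z - 1 : ℝ) : ℂ) ^ p) := by
  refine ⟨fun z => ((z - 1 : ℝ) : ℂ) ^ p * (p / ((z : ℂ) - 1)),
    fun z => ((z - 1 : ℝ) : ℂ) ^ p * (p * (p - 1) / ((z : ℂ) - 1) ^ 2), fun z hz => ?_⟩
  have hz1 : 1 < z := hz.1
  have hne : ((z : ℂ) - 1) ≠ 0 := by
    have : ((z - 1 : ℝ) : ℂ) ≠ 0 := by exact_mod_cast (show z - 1 ≠ 0 by linarith)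
    simpa using this
  have hD := hasDerivAt_sub_one_cpow p hz1
  refine ⟨hD, ?_, ?_⟩
  · -- second derivative
    have hc : HasDerivAt (fun t : ℝ => (t : ℂ)) 1 z := by simpa using (hasDerivAt_id z).ofReal_comp
    have hinv : HasDerivAt (fun t : ℝ => p / ((t : ℂ) - 1)) (-(p * 1) / ((z : ℂ) - 1) ^ 2) z := by
      have := ((hc.sub_const (1 : ℂ)).inv hne).const_mul p
      refine (this.congr_deriv (by field_simp)).congr_of_eventuallyEq ?_
      exact Filter.Eventually.of_forall fun t => by simp [div_eq_mul_inv]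
    refine (hD.mul hinv).congr_deriv ?_
    push_cast
    field_simp
    ring
  · -- the equation: residual quadratic vanishes
    beta_reduce
    push_cast
    have hε : ε = α + β + 1 - γ - δ := by linear_combination hF
    have key : lead (aH : ℂ) z * (((z : ℂ) - 1) ^ p * (p * (p - 1) / ((z : ℂ) - 1) ^ 2)) +
        mid (aH : ℂ) γ δ ε z * (((z : ℂ) - 1) ^ p * (p / ((z : ℂ) - 1))) +
        low α β q z * ((z : ℂ) - 1) ^ p =
        ((z : ℂ) - 1) ^ p / ((z : ℂ) - 1) *
          ((p + α) * (p + β) * (z : ℂ) ^ 2 +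
            (-(aH : ℂ) * p * (p - 1 + γ + δ) - p * (α + β + 1 - δ) + q - α * β) * z +
            (p * γ * aH - q)) := by
      unfold lead mid low
      rw [hε]
      field_simp
      ring
    have hδ' : δ = 1 - p := by rw [hp]; ring
    have h2 : (p + α) * (p + β) * (z : ℂ) ^ 2 +
            (-(aH : ℂ) * p * (p - 1 + γ + δ) - p * (α + β + 1 - δ) + q - α * β) * z +
            (p * γ * aH - q) = 0 := by
      rw [hq, hδ']
      linear_combination ((z : ℂ) ^ 2 - z) * hind
    rw [key, h2, mul_zero]

/-! ### The extreme stratum: `u^{(N)} ≡ 0` with the branch `(1−x)^{N−1}` at `1` -/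

/-- **Extreme stratum.** If `u` is smooth on `(0,1)`, `u^{(N)} ≡ 0`, and near `1⁻`,
`u = (1−x)^{N−1}·G` with `G` smooth across `1`, then `u = c·(1−x)^{N−1}` on `(0,1)` for a constant
`c`. (`u` is a polynomial `P` of degree `≤ N−1`; if `P = (X−1)^n q`, `q(1) ≠ 0`, the branch forces
`n − (N−1) ∈ ℕ`, so `n = N−1` and `q` is constant.) -/
theorem eq_monomial_of_iterate_deriv_eq_zero_of_branch_extreme {N : ℕ} {u : ℝ → ℂ}
    (hu : ContDiffOn ℝ ((⊤ : ℕ∞) : WithTop ℕ∞) u (Ioo 0 1))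
    (hN : ∀ x ∈ Ioo (0 : ℝ) 1, (deriv^[N] u) x = 0) {e : ℝ} (he : 0 < e) (he1 : e ≤ 1)
    {G : ℝ → ℂ} (hG : ContDiffOn ℝ ((⊤ : ℕ∞) : WithTop ℕ∞) G (Ioo (1 - e) (1 + e)))
    (hbranch : ∀ x ∈ Ioo (1 - e) 1, u x = ((1 - x : ℝ) : ℂ) ^ (((N : ℂ) - 1)) * G x) :
    ∃ c : ℂ, ∀ x ∈ Ioo (0 : ℝ) 1, u x = c * ((1 - x : ℝ) : ℂ) ^ (N - 1) := by
  obtain ⟨P, hPdeg, hP⟩ := exists_polynomial_of_iterate_deriv_eq_zero zero_lt_one N hu hN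
  by_cases hP0 : P = 0
  · exact ⟨0, fun x hx => by simp [hP x hx, hP0]⟩
  obtain ⟨q, hPq, hqdvd⟩ := exists_eq_pow_rootMultiplicity_mul_and_not_dvd P hP0 1
  set n := P.rootMultiplicity 1 with hn
  have hq1 : q.eval 1 ≠ 0 := fun h0 => hqdvd (dvd_iff_isRoot.mpr h0)
  have hq0 : q ≠ 0 := by rintro rfl; simp at hq1
  have hPnat : P.natDegree < N := (natDegree_lt_iff_degree_lt hP0).mpr hPdeg
  have hdeg : P.natDegree = n + q.natDegree := by
    have h := congrArg natDegree hPq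
    rwa [natDegree_mul (pow_ne_zero _ (X_sub_C_ne_zero 1)) hq0, natDegree_pow, natDegree_X_sub_C,
      mul_one] at h
  -- the branch forces `n − (N−1) ∈ ℕ`
  set Q : ℝ → ℂ := fun x => (-1) ^ n * q.eval (x : ℂ) with hQdef
  have hQs : ContDiffOn ℝ ((⊤ : ℕ∞) : WithTop ℕ∞) Q (Ioo (1 - e) (1 + e)) := by
    have h1 : ContDiff ℝ ((⊤ : ℕ∞) : WithTop ℕ∞) (fun x : ℝ => q.eval (x : ℂ)) := by
      have hq0' : ContDiff ℂ ((⊤ : ℕ∞) : WithTop ℕ∞) (fun x : ℂ => aeval x q) :=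
        Polynomial.contDiff_aeval q _
      have hq' := hq0'.restrict_scalars ℝ
      have e1 : (fun x : ℂ => aeval x q) = fun x : ℂ => q.eval x := by
        funext x; simp [coe_aeval_eq_eval]
      rw [e1] at hq'
      exact hq'.comp Complex.ofRealCLM.contDiff
    exact (contDiff_const.mul h1).contDiffOn
  have hQ1 : Q 1 ≠ 0 := by
    simp only [hQdef, Complex.ofReal_one]
    exact mul_ne_zero (pow_ne_zero _ (by norm_num)) hq1
  have hagree : ∀ x ∈ Ioo (1 - e) 1, ((1 - x : ℝ) : ℂ) ^ ((n : ℂ) - ((N : ℂ) - 1)) * Q x = G x := by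
    intro x hx
    have hx01 : x ∈ Ioo (0 : ℝ) 1 := ⟨by linarith [hx.1], hx.2⟩
    have hpos : (0 : ℝ) < 1 - x := by linarith [hx.2]
    have hne : ((1 - x : ℝ) : ℂ) ≠ 0 := by exact_mod_cast hpos.ne'
    have h1 := hbranch x hx
    rw [hP x hx01, hPq, eval_mul, eval_pow, eval_sub, eval_X, eval_C] at h1
    have hG' : G x = ((1 - x : ℝ) : ℂ) ^ (-((N : ℂ) - 1)) * (((x : ℂ) - 1) ^ n * q.eval (x : ℂ)) := by
      rw [h1, ← mul_assoc, ← Complex.cpow_add _ _ hne, neg_add_cancel, Complex.cpow_zero, one_mul]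
    rw [hG', hQdef, Complex.cpow_sub _ _ hne, Complex.cpow_natCast]
    have e2 : ((x : ℂ) - 1) = -((1 - x : ℝ) : ℂ) := by push_cast; ring
    rw [e2, neg_pow, Complex.cpow_neg]
    field_simp
    ring
  obtain ⟨n', hn'⟩ := natural_of_smooth_branch he hQs hQ1 hG hagree
  -- hence `n = N − 1 + n'`, and with `n ≤ natDegree P ≤ N − 1`: `n' = 0`, `q` constant
  have hnN : (n : ℤ) - ((N : ℤ) - 1) = n' := by
    have : ((n : ℂ) - ((N : ℂ) - 1)) = ((((n : ℤ) - ((N : ℤ) - 1) : ℤ)) : ℂ) := by push_cast; ring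
    rw [this] at hn'
    exact_mod_cast hn'
  have hn1 : n = N - 1 ∧ q.natDegree = 0 := by omega
  have hqc : q = C (q.coeff 0) := eq_C_of_natDegree_eq_zero hn1.2
  refine ⟨(-1) ^ (N - 1) * q.coeff 0, fun x hx => ?_⟩
  rw [hP x hx, hPq]
  rw [hqc, hn1.1]
  simp only [eval_mul, eval_pow, eval_sub, eval_X, eval_C]
  have e2 : ((x : ℂ) - 1) = -((1 - x : ℝ) : ℂ) := by push_cast; ring
  rw [e2, neg_pow]
  simp only [coeff_C_zero]
  ring

/-! ### The accessory condition through the Möbius automorphism -/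

/-- **Extreme-stratum accessory condition in the Möbius image.** For Hatsuda-type data with
`δ = N`, `α = N + 1` (so the flipped frame has `α♭ = 1 − N` and exponent `1 − δ♭ = N − 1` at `1`) and
the Fuchs relation: the condition `flipQ(a; γ, δ, ε; q) = (N−1)(2−γ)·a` produced by the monomial
`(1−x)^{N−1}` is, after the Möbius automorphism `x = a(z−1)/z` of `HeunMobius`
(`q ↦ mobiusQ a α β γ δ q`, `γ ↦ mobiusγ α β`, `a ↦ a/(a−1)`), the condition
`q' = (1−γ)·γ'·a'` of the monomial `(z−1)^{1−γ}`. Pure algebra. -/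
theorem mobiusQ_of_flipQ_extreme {a : ℝ} (ha : a ≠ 1) {α β γ δ ε q : ℂ} {N : ℕ}
    (hα : α = (N : ℂ) + 1) (hδ : δ = (N : ℂ)) (hF : γ + δ + ε = α + β + 1)
    (hq : flipQ (a : ℂ) γ δ ε q = ((N : ℂ) - 1) * (2 - γ) * (a : ℂ)) :
    mobiusQ a α β γ δ q = (1 - γ) * mobiusγ α β * (((a / (a - 1) : ℝ)) : ℂ) := by
  have ha' : (a : ℂ) - 1 ≠ 0 := by
    have : ((a - 1 : ℝ) : ℂ) ≠ 0 := by exact_mod_cast sub_ne_zero.mpr ha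
    simpa using this
  have hε : ε = α + β + 1 - γ - δ := by linear_combination hF
  have hq' : q = ((N : ℂ) - 1) * (2 - γ) * (a : ℂ) - ((a : ℂ) + 1) * γ - (a : ℂ) * δ - ε +
      2 * ((a : ℂ) + 1) := by
    unfold flipQ at hq; linear_combination hq
  unfold mobiusQ mobiusγ
  rw [hq', hε, hδ, hα]
  push_cast
  field_simp
  ring

end SpinFlipTS

end Summit.Ventures.KdS
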